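import Literature.NumberTheory.EllipticCurves.EisensteinNewformLevelRaisingOrdinaryUnitRootProofs
import Literature.NumberTheory.GaloisRepresentations.ResidualGaloisRep
import Literature.RepresentationTheory.Semisimple.FinTwoSemisimplification
import HarnessLib

/-!
# Ordinary lines under specialization and from traces (Wiles 1988, §2.2) — proofs only

A theorems-only companion (no definition of a notion, no named fact; D-0026) of
`EllipticCurves/EisensteinNewformLevelRaising.lean`, written by the seat of the named fact
`Literature.NumberTheory.EllipticCurves.Hida2000_thm326_ordinary_unitRoot` — H. Hida, *Modular
Forms and Galois Cohomology* (2000), Thm. 3.26 (2), p. 152, with its unit-root clause; printed by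
Hida without proof ("we will take for granted this theorem", p. 152).  The proof in print for
weight `k ≥ 2` is A. Wiles, *On ordinary `λ`-adic representations associated to modular forms*,
Invent. Math. 94 (1988): Thm. 2.1.4 (p. 561) is deduced from the `Λ`-adic Thm. 2.2.2 (p. 562) by
specialization (pp. 562–563), and Thm. 2.2.2 is proved (Lemma 2.2.4, pp. 565–566) from the
weight-`2` case (Lemma 2.1.5, pp. 561–562: the étale quotient of the `λ`-divisible group of `A_f`,
Eichler–Shimura) at infinitely many weight-`2` specializations of the Hida family through `f`
(Thm. 1.4.1).  The modular inputs (Hida families, `ρ_F`, `A_f` and its reduction) are absent from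
Mathlib and from the tree; this file proves the ALGEBRAIC steps of that argument, as printed, in
the tree's vocabulary of frames (`Q⁻¹ρQ` upper triangular) and reductions
(`Literature.NumberTheory.GaloisRepresentations.IsReductionOf`), and draws the corresponding
consequences and reformulations of the fact:

* `exists_integralFrame_of_frame` — **the lattice step of Thm. 2.2.2 ⇒ Thm. 2.1.4
  (pp. 562–563)**: over a valuation ring `O ⊆ F` (Wiles: the discrete valuation ring `(O_L)_P`;
  here any valuation ring, e.g. the non-Noetherian `ℤ̄_p`), a family of integral matrices which is
  simultaneously upper triangular in a frame over `F` is so in an INTEGRAL frame `Q₀ ∈ GL₂(O)`,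
  with the same diagonal; hence `IsReductionOf.exists_upperTriangular_frame`: **every reduction
  of an ordinary representation is ordinary, with the reduced characters in the same order**.
* `Hida2000_thm326_ordinary_unitRoot.exists_residualFrame` — corollary of the fact: every
  reduction `ρ̄` of an attached `ρ` is ordinary at `w ∣ p` with unramified quotient `δ̄`,
  `δ̄(Frob_w) = ᾱ ≡ a_p (mod 𝔪)` (the residual form of the theorem, as in Edixhoven 1992,
  Thm. 2.5).
* `exists_eigenvector_of_trace_eq_add_of_det_eq_mul`,
  `conj_diag_eq_or_of_trace_eq_add_of_det_eq_mul`,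
  `exists_upperTriangular_frame_of_trace_eq_add_of_det_eq_mul` — **the first step of Lemma 2.2.4
  (p. 565)**: over a field, `tr ρ = χ₁ + χ₂` and `det ρ = χ₁χ₂` for characters `χ₁, χ₂` force a
  stable line (Brauer–Nesbitt, `Literature.RepresentationTheory.Semisimple.BrauerNesbitt`), and the
  diagonal of ANY triangular frame is then `(χ₁, χ₂)` or `(χ₂, χ₁)` (a group is not the union of
  two proper subgroups) — "Clearly there is one on which the action is either via `σ` or
  `σ⁻¹ det ρ`".  The order is not determined by the trace; Wiles's second step (pp. 565–566)
  excludes the wrong order using infinitely many ordinary specializations.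
* `exists_adaptedFrame`, `apply_zero_one_eq_zero_of_specializations` — **the second step of
  Lemma 2.2.4 (pp. 565–566)**, as pure algebra: in a frame adapted to an element `τ₀` separating
  the two characters, if a jointly injective family of specializations `φ_i : A → k_i` each has a
  stable line with the QUOTIENT character (in Wiles: the weight-`2` points, by Lemma 2.1.5), then
  the corner entry vanishes identically ("`b_σ ≡ 0 mod P_{k,ζ}` … Hence `b_σ = 0`"), so the
  representation splits and the order of the characters is the right one.
* `Hida2000_thm326_ordinary_unitRoot.exists_traceForm`,
  `Hida2000_thm326_ordinary_unitRoot_iff_ordinary_and_traceForm` — for the fact itself the second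
  step is free: the inertia weights `(ν^{k−1}, 1)`, `k ≥ 2`, of the ordinary frame of the landed
  `Hida2000_thm326_ordinary` exclude the swap, so **the fact is equivalent to
  `Hida2000_thm326_ordinary` plus a statement about `tr` and `det` of `ρ|_{Γ_{ℚ_w}}` alone**
  (`tr = ε + δ`, `det = εδ`, `δ` unramified with `δ(Frob_w)` the unit root) — the
  semisimplification of `ρ|_{Γ_{ℚ_w}}`, which is what a local–global compatibility statement at
  `p` would supply.

What remains unproved is unchanged and geometric: `Hida2000_thm326_ordinary` and the trace form
at `p` (equivalently the fact), i.e. Wiles's Lemma 2.1.5 / Mazur–Wiles 1986 §8 for weight `2` and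
the Hida-family transfer to weight `k`.

## References

* A. Wiles, *On ordinary `λ`-adic representations associated to modular forms*, Invent. Math. 94
  (1988), 529–573: Thm. 2 (p. 531), Thm. 2.1.4 and Lemma 2.1.5 (pp. 561–562), Thms. 2.2.1–2.2.2
  and their specialization to Thms. 2.1.2/2.1.4 (pp. 562–563), Lemma 2.2.3 (pp. 563–565),
  Lemma 2.2.4 (pp. 565–566). [Wiles1988]
* H. Hida, *Modular Forms and Galois Cohomology*, CUP (2000), Thm. 3.26 (2), p. 152. [Hida2000]
* B. Mazur, A. Wiles, *On `p`-adic analytic families of Galois representations*, Compositio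
  Math. 59 (1986), 231–264, §8 Prop. 2 and p. 250 with (11). [MazurWiles1986]
* B. Edixhoven, *The weight in Serre's conjectures on modular forms*, Invent. Math. 109 (1992),
  Thm. 2.5. [Edixhoven1992]
* N. Bourbaki, *Algèbre* VIII, §20 n°6, Thm. 2, Cor. 1 (Brauer–Nesbitt). [BourbakiAlgebreVIII2012]
-/

noncomputable section

open scoped MatrixGroups Matrix

namespace Literature.NumberTheory.EllipticCurves

open Literature.NumberTheory.GaloisRepresentations

/-! ### Frames of `2 × 2` matrices: column `0` of the frame is the stable line -/

section FrameColumn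

variable {R : Type*} [CommRing R]

/-- If `Q⁻¹ M Q` is upper triangular then the first column `q = Q e₀` of the frame is an
eigenvector of `M` with eigenvalue the upper-left entry of `Q⁻¹ M Q`: `M q = (Q⁻¹MQ)₀₀ · q`
(read off column `0` of `Q (Q⁻¹ M Q) = M Q`). [folklore] -/
theorem mulVec_frameCol_eq_smul_of_conj_apply_one_zero_eq_zero (M : Matrix (Fin 2) (Fin 2) R)
    (Q : GL (Fin 2) R)
    (h : ((Q⁻¹ : GL (Fin 2) R) * M * (Q : Matrix (Fin 2) (Fin 2) R)) 1 0 = 0) :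
    M *ᵥ (fun i ↦ (Q : Matrix (Fin 2) (Fin 2) R) i 0) =
      ((Q⁻¹ : GL (Fin 2) R) * M * (Q : Matrix (Fin 2) (Fin 2) R)) 0 0 •
        (fun i ↦ (Q : Matrix (Fin 2) (Fin 2) R) i 0) := by
  set N : Matrix (Fin 2) (Fin 2) R := (Q⁻¹ : GL (Fin 2) R) * M * (Q : Matrix (Fin 2) (Fin 2) R)
    with hN
  have hQN : (Q : Matrix (Fin 2) (Fin 2) R) * N = M * (Q : Matrix (Fin 2) (Fin 2) R) := by
    rw [hN, ← mul_assoc, ← mul_assoc, ← Units.val_mul, mul_inv_cancel, Units.val_one, one_mul]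
  ext i
  have hi := congrFun (congrFun hQN i) 0
  simp only [Matrix.mul_apply, Fin.sum_univ_two] at hi
  rw [h, mul_zero, add_zero] at hi
  simp only [Matrix.mulVec, dotProduct, Fin.sum_univ_two, Pi.smul_apply, smul_eq_mul]
  rw [← hi, mul_comm]

/-- Conversely, if the first column `q = Q e₀` of `Q` is an eigenvector of `M`, `M q = a q`, then
`Q⁻¹ M Q` is upper triangular with upper-left entry `a` (column `0` of `Q⁻¹ M Q` is
`Q⁻¹ M q = a Q⁻¹ q = a e₀`). [folklore] -/
theorem conj_apply_col_zero_of_mulVec_frameCol_eq_smul (M : Matrix (Fin 2) (Fin 2) R)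
    (Q : GL (Fin 2) R) {a : R}
    (h : M *ᵥ (fun i ↦ (Q : Matrix (Fin 2) (Fin 2) R) i 0) =
      a • (fun i ↦ (Q : Matrix (Fin 2) (Fin 2) R) i 0)) :
    ((Q⁻¹ : GL (Fin 2) R) * M * (Q : Matrix (Fin 2) (Fin 2) R)) 1 0 = 0 ∧
      ((Q⁻¹ : GL (Fin 2) R) * M * (Q : Matrix (Fin 2) (Fin 2) R)) 0 0 = a := by
  have hcol : ∀ i, (((Q⁻¹ : GL (Fin 2) R) : Matrix (Fin 2) (Fin 2) R) * M *
      (Q : Matrix (Fin 2) (Fin 2) R)) i 0 =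
      a * ((((Q⁻¹ : GL (Fin 2) R) : Matrix (Fin 2) (Fin 2) R) * (Q : Matrix (Fin 2) (Fin 2) R)) i 0) := by
    intro i
    have h0 := congrFun h 0
    have h1 := congrFun h 1
    simp only [Matrix.mulVec, dotProduct, Fin.sum_univ_two, Pi.smul_apply, smul_eq_mul] at h0 h1
    simp only [Matrix.mul_apply, Fin.sum_univ_two]
    linear_combination (((Q⁻¹ : GL (Fin 2) R) : Matrix (Fin 2) (Fin 2) R) i 0) * h0 +
      (((Q⁻¹ : GL (Fin 2) R) : Matrix (Fin 2) (Fin 2) R) i 1) * h1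
  have hinv : (((Q⁻¹ : GL (Fin 2) R) : Matrix (Fin 2) (Fin 2) R) * (Q : Matrix (Fin 2) (Fin 2) R)) = 1 := by
    rw [← Units.val_mul, inv_mul_cancel, Units.val_one]
  refine ⟨?_, ?_⟩
  · rw [hcol 1, hinv]; simp
  · rw [hcol 0, hinv]; simp

/-- The lower-right entry of an upper-triangular `Q⁻¹ M Q` is `tr M −` its upper-left entry.
[folklore] -/
theorem conj_apply_one_one_eq_trace_sub (M : Matrix (Fin 2) (Fin 2) R) (Q : GL (Fin 2) R) :
    ((Q⁻¹ : GL (Fin 2) R) * M * (Q : Matrix (Fin 2) (Fin 2) R)) 1 1 =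
      M.trace - ((Q⁻¹ : GL (Fin 2) R) * M * (Q : Matrix (Fin 2) (Fin 2) R)) 0 0 := by
  have htr : (((Q⁻¹ : GL (Fin 2) R) : Matrix (Fin 2) (Fin 2) R) * M *
      (Q : Matrix (Fin 2) (Fin 2) R)).trace = M.trace := by
    rw [Matrix.trace_mul_cycle, ← Units.val_mul, mul_inv_cancel, Units.val_one, one_mul]
  rw [Matrix.trace_fin_two] at htr
  linear_combination htr

end FrameColumn

/-! ### Integral frames over a valuation ring (Wiles 1988, pp. 562–563) -/

section IntegralFrame

variable {F : Type*} [Field F] {O : ValuationSubring F} {ι : Type*}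

/-- Entries of `GL₂(f)`. [folklore] -/
private lemma generalLinearGroup_map_apply {S : Type*} [CommRing S] (f : O →+* S)
    (g : GL (Fin 2) O) (i j : Fin 2) :
    ((Matrix.GeneralLinearGroup.map f g : GL (Fin 2) S) : Matrix (Fin 2) (Fin 2) S) i j =
      f ((g : Matrix (Fin 2) (Fin 2) O) i j) := rfl

/-- The unipotent frame `(1 0; t 1) ∈ GL₂(O)`: an invertible integral matrix with first column
`(1, t)`. [folklore] -/
private theorem exists_gl_col_eq_one_fst (t : O) :
    ∃ Q₀ : GL (Fin 2) O, (Q₀ : Matrix (Fin 2) (Fin 2) O) 0 0 = 1 ∧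
      (Q₀ : Matrix (Fin 2) (Fin 2) O) 1 0 = t :=
  ⟨⟨!![1, 0; t, 1], !![1, 0; -t, 1],
    by ext i j; fin_cases i <;> fin_cases j <;> simp [Matrix.mul_apply, Fin.sum_univ_two],
    by ext i j; fin_cases i <;> fin_cases j <;> simp [Matrix.mul_apply, Fin.sum_univ_two]⟩,
    rfl, rfl⟩

/-- The frame `(t 1; 1 0) ∈ GL₂(O)` (determinant `-1`): an invertible integral matrix with first
column `(t, 1)`. [folklore] -/
private theorem exists_gl_col_eq_one_snd (t : O) :
    ∃ Q₀ : GL (Fin 2) O, (Q₀ : Matrix (Fin 2) (Fin 2) O) 0 0 = t ∧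
      (Q₀ : Matrix (Fin 2) (Fin 2) O) 1 0 = 1 :=
  ⟨⟨!![t, 1; 1, 0], !![0, 1; 1, -t],
    by ext i j; fin_cases i <;> fin_cases j <;> simp [Matrix.mul_apply, Fin.sum_univ_two],
    by ext i j; fin_cases i <;> fin_cases j <;> simp [Matrix.mul_apply, Fin.sum_univ_two]⟩,
    rfl, rfl⟩

/-- The step common to both charts: an integral frame `Q₀ ∈ GL₂(O)` whose first column is a
multiple of the first column of the given frame `Q ∈ GL₂(F)` is again an upper-triangular frame,
with the same diagonal. [folklore] -/
private theorem integralFrame_of_col_eq_smul (M : ι → GL (Fin 2) O) (Q : GL (Fin 2) F)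
    (hQ : ∀ i, (Q⁻¹ * Matrix.GeneralLinearGroup.map O.subtype (M i) * Q).val 1 0 = 0)
    (Q₀ : GL (Fin 2) O) (c : F)
    (hc : (fun j ↦ ((Matrix.GeneralLinearGroup.map O.subtype Q₀ : GL (Fin 2) F) :
        Matrix (Fin 2) (Fin 2) F) j 0) = c • fun j ↦ (Q : Matrix (Fin 2) (Fin 2) F) j 0) (i : ι) :
    (Q₀⁻¹ * M i * Q₀).val 1 0 = 0 ∧
      ((Q₀⁻¹ * M i * Q₀).val 0 0 : F) =
        (Q⁻¹ * Matrix.GeneralLinearGroup.map O.subtype (M i) * Q).val 0 0 ∧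
      ((Q₀⁻¹ * M i * Q₀).val 1 1 : F) =
        (Q⁻¹ * Matrix.GeneralLinearGroup.map O.subtype (M i) * Q).val 1 1 := by
  set f := (Matrix.GeneralLinearGroup.map O.subtype : GL (Fin 2) O →* GL (Fin 2) F) with hf
  set a : F := (Q⁻¹ * f (M i) * Q).val 0 0 with ha
  -- the first column of `Q` is an eigenvector of `M i` with eigenvalue `a`
  have heig : ((f (M i) : GL (Fin 2) F) : Matrix (Fin 2) (Fin 2) F) *ᵥ
      (fun j ↦ (Q : Matrix (Fin 2) (Fin 2) F) j 0) = a • fun j ↦ (Q : Matrix (Fin 2) (Fin 2) F) j 0 := by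
    have h := mulVec_frameCol_eq_smul_of_conj_apply_one_zero_eq_zero
      ((f (M i) : GL (Fin 2) F) : Matrix (Fin 2) (Fin 2) F) Q (by simpa [Units.val_mul] using hQ i)
    simpa [ha, Units.val_mul] using h
  -- hence so is the first column of `Q₀`
  have heig₀ : ((f (M i) : GL (Fin 2) F) : Matrix (Fin 2) (Fin 2) F) *ᵥ
      (fun j ↦ ((f Q₀ : GL (Fin 2) F) : Matrix (Fin 2) (Fin 2) F) j 0) =
        a • fun j ↦ ((f Q₀ : GL (Fin 2) F) : Matrix (Fin 2) (Fin 2) F) j 0 := by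
    rw [hc, Matrix.mulVec_smul, heig, smul_comm]
  obtain ⟨h10, h00⟩ := conj_apply_col_zero_of_mulVec_frameCol_eq_smul _ (f Q₀) heig₀
  -- transport back to `O` along the injective `O.subtype`
  have hconj : ∀ j k, ((Q₀⁻¹ * M i * Q₀).val j k : F) =
      ((((f Q₀)⁻¹ : GL (Fin 2) F) : Matrix (Fin 2) (Fin 2) F) *
        ((f (M i) : GL (Fin 2) F) : Matrix (Fin 2) (Fin 2) F) *
        ((f Q₀ : GL (Fin 2) F) : Matrix (Fin 2) (Fin 2) F)) j k := by
    intro j k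
    rw [← map_inv, ← Units.val_mul, ← Units.val_mul, ← map_mul, ← map_mul]
    rfl
  refine ⟨?_, ?_, ?_⟩
  · apply O.subtype_injective
    change ((Q₀⁻¹ * M i * Q₀).val 1 0 : F) = ((0 : O) : F)
    rw [hconj, h10, ZeroMemClass.coe_zero]
  · rw [hconj, h00]
  · rw [hconj, conj_apply_one_one_eq_trace_sub, h00, ha, Units.val_mul, Units.val_mul,
      conj_apply_one_one_eq_trace_sub]

/-- **Integral frames (Wiles 1988, pp. 562–563).**  Let `O` be a valuation ring of the field `F`
and `M_i ∈ GL₂(O)` a family of integral matrices which, over `F`, is simultaneously upper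
triangular in some frame `Q ∈ GL₂(F)`.  Then it is simultaneously upper triangular in an INTEGRAL
frame `Q₀ ∈ GL₂(O)`, with the same diagonal entries: the common stable line `F · Qe₀` meets `O²`
in a direct summand (scale `Qe₀` so that one coordinate is `1` and the other lies in `O` — possible
as `O` is a valuation ring — and complete it by a standard basis vector).  This is the lattice
step in Wiles's deduction of the ordinarity of `ρ_f = ρ_F mod P` from that of the `Λ`-adic `ρ_F`
("`(O_L)_P` is … a discrete valuation ring and hence `ρ_F(Gal(F̄/F)) ⊆ GL₂((O_L)_P)` … The second
theorem follows similarly", *Invent. Math.* 94 (1988), pp. 562–563), isolated as pure algebra and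
for an arbitrary (not necessarily discrete or Noetherian) valuation ring, e.g. `ℤ̄_p ⊆ ℚ̄_p`.
[cite: Wiles1988, §2.2, pp. 562–563 (proof of Thms. 2.1.2/2.1.4 from Thms. 2.2.1/2.2.2)] -/
theorem exists_integralFrame_of_frame (M : ι → GL (Fin 2) O) (Q : GL (Fin 2) F)
    (hQ : ∀ i, (Q⁻¹ * Matrix.GeneralLinearGroup.map O.subtype (M i) * Q).val 1 0 = 0) :
    ∃ Q₀ : GL (Fin 2) O, ∀ i,
      (Q₀⁻¹ * M i * Q₀).val 1 0 = 0 ∧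
      ((Q₀⁻¹ * M i * Q₀).val 0 0 : F) =
        (Q⁻¹ * Matrix.GeneralLinearGroup.map O.subtype (M i) * Q).val 0 0 ∧
      ((Q₀⁻¹ * M i * Q₀).val 1 1 : F) =
        (Q⁻¹ * Matrix.GeneralLinearGroup.map O.subtype (M i) * Q).val 1 1 := by
  set q : Fin 2 → F := fun j ↦ (Q : Matrix (Fin 2) (Fin 2) F) j 0 with hq
  by_cases h1 : q 0 ≠ 0 ∧ q 1 * (q 0)⁻¹ ∈ O
  · -- chart `e₀`: scale the first column to `(1, t)`, `t = q₁/q₀ ∈ O`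
    obtain ⟨hq0, ht⟩ := h1
    obtain ⟨Q₀, h00, h10⟩ := exists_gl_col_eq_one_fst (⟨q 1 * (q 0)⁻¹, ht⟩ : O)
    refine ⟨Q₀, fun i ↦ integralFrame_of_col_eq_smul M Q hQ Q₀ (q 0)⁻¹ ?_ i⟩
    ext j
    fin_cases j
    · show O.subtype ((Q₀ : Matrix (Fin 2) (Fin 2) O) 0 0) = (q 0)⁻¹ * q 0
      rw [h00, map_one, inv_mul_cancel₀ hq0]
    · show O.subtype ((Q₀ : Matrix (Fin 2) (Fin 2) O) 1 0) = (q 0)⁻¹ * q 1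
      rw [h10]
      change q 1 * (q 0)⁻¹ = (q 0)⁻¹ * q 1
      ring
  · -- chart `e₁`: scale the first column to `(t, 1)`, `t = q₀/q₁ ∈ O`
    have hq1 : q 1 ≠ 0 := by
      intro hq1
      by_cases hq0 : q 0 = 0
      · -- `q = 0` contradicts the invertibility of `Q`
        have hdet : (Q : Matrix (Fin 2) (Fin 2) F).det = 0 := by
          rw [Matrix.det_fin_two]
          have h0' : (Q : Matrix (Fin 2) (Fin 2) F) 0 0 = 0 := hq0
          have h1' : (Q : Matrix (Fin 2) (Fin 2) F) 1 0 = 0 := hq1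
          rw [h0', h1']; ring
        exact (Matrix.isUnits_det_units Q).ne_zero hdet
      · exact h1 ⟨hq0, by rw [hq1, zero_mul]; exact zero_mem O⟩
    have ht : q 0 * (q 1)⁻¹ ∈ O := by
      by_cases hq0 : q 0 = 0
      · rw [hq0, zero_mul]; exact zero_mem O
      · have hnot : q 1 * (q 0)⁻¹ ∉ O := fun h ↦ h1 ⟨hq0, h⟩
        have := (O.mem_or_inv_mem (q 1 * (q 0)⁻¹)).resolve_left hnot
        simpa [mul_inv_rev] using this
    obtain ⟨Q₀, h00, h10⟩ := exists_gl_col_eq_one_snd (⟨q 0 * (q 1)⁻¹, ht⟩ : O)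
    refine ⟨Q₀, fun i ↦ integralFrame_of_col_eq_smul M Q hQ Q₀ (q 1)⁻¹ ?_ i⟩
    ext j
    fin_cases j
    · show O.subtype ((Q₀ : Matrix (Fin 2) (Fin 2) O) 0 0) = (q 1)⁻¹ * q 0
      rw [h00]
      change q 0 * (q 1)⁻¹ = (q 1)⁻¹ * q 0
      ring
    · show O.subtype ((Q₀ : Matrix (Fin 2) (Fin 2) O) 1 0) = (q 1)⁻¹ * q 1
      rw [h10, map_one, inv_mul_cancel₀ hq1]

end IntegralFrame

/-! ### Ordinary lines descend to reductions (Wiles 1988, Thm. 2.2.2 ⇒ Thm. 2.1.4) -/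

section Reduction

variable {F : Type*} [Field F] {O : ValuationSubring F} {k : Type*} [Field k]
  {D : Type*} [Group D]

/-- Conjugating an integral homomorphism `ρ₀ : D → GL₂(O)` by `Q₀ ∈ GL₂(O)`. [folklore] -/
private lemma integralReduction_conj (ι : IsLocalRing.ResidueField O →+* k)
    (ρ₀ : D →* GL (Fin 2) O) (Q₀ : GL (Fin 2) O) (d : D) (i j : Fin 2) :
    ((Matrix.GeneralLinearGroup.map (ι.comp (IsLocalRing.residue O)) Q₀)⁻¹ *
        integralReduction ι ρ₀ d *
        Matrix.GeneralLinearGroup.map (ι.comp (IsLocalRing.residue O)) Q₀).val i j =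
      ι (IsLocalRing.residue O ((Q₀⁻¹ * ρ₀ d * Q₀).val i j)) := by
  rw [integralReduction, MonoidHom.comp_apply, ← map_inv, ← map_mul, ← map_mul]
  rfl

/-- **Reductions of ordinary representations are ordinary, with the reduced characters (Wiles
1988, Thm. 2.2.2 ⇒ Thm. 2.1.4, pp. 562–563).**  Let `O` be a valuation ring of the field `F`
with residue field `O/𝔪 → k`, and let `τ : D → GL₂(k)` be a reduction of `ρ : D → GL₂(F)` (the
reduction of ANY `D`-stable `O`-lattice, in any basis: `IsReductionOf`).  If `ρ` is upper
triangular in a frame `Q ∈ GL₂(F)` — a `D`-stable line with character `a = (Q⁻¹ρQ)₀₀` and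
quotient character `δ = (Q⁻¹ρQ)₁₁` — then `a` and `δ` take values in `O`, and `τ` is upper
triangular in a frame `Q̄ ∈ GL₂(k)` with diagonal characters `a mod 𝔪` and `δ mod 𝔪` IN THE SAME
ORDER (the stable line of `ρ` saturates to a direct summand of the lattice,
`exists_integralFrame_of_frame`).  Wiles, *Invent. Math.* 94 (1988), pp. 562–563, deduces in
this way the ordinarity of `ρ_f ≅ ρ_F mod P` at `𝔭 ∣ p` (Thm. 2.1.4: "`ε₂` is unramified and
`ε₂(Frob 𝔭) = α(𝔭, f)`") from that of the `Λ`-adic representation `ρ_F` (Thm. 2.2.2: "`δ₂` is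
unramified and `δ₂(Frob 𝔭) = c(𝔭, F)`"), `(O_L)_P` being a discrete valuation ring; here `O` is
any valuation ring (e.g. the non-Noetherian `ℤ̄_p ⊆ ℚ̄_p` of residual representations).
[cite: Wiles1988, §2.2, pp. 562–563 (Thms. 2.2.1/2.2.2 ⇒ Thms. 2.1.2/2.1.4)] -/
theorem _root_.Literature.NumberTheory.GaloisRepresentations.IsReductionOf.exists_upperTriangular_frame
    {ι : IsLocalRing.ResidueField O →+* k}
    {ρ : D →* GL (Fin 2) F} {τ : D →* GL (Fin 2) k} (hred : IsReductionOf ι ρ τ)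
    (Q : GL (Fin 2) F) (hQ : ∀ d, (Q⁻¹ * ρ d * Q).val 1 0 = 0) :
    ∃ (Qbar : GL (Fin 2) k) (a δ : D → O), ∀ d,
      ((a d : F) = (Q⁻¹ * ρ d * Q).val 0 0 ∧ (δ d : F) = (Q⁻¹ * ρ d * Q).val 1 1) ∧
      (Qbar⁻¹ * τ d * Qbar).val 1 0 = 0 ∧
      (Qbar⁻¹ * τ d * Qbar).val 0 0 = ι (IsLocalRing.residue O (a d)) ∧
      (Qbar⁻¹ * τ d * Qbar).val 1 1 = ι (IsLocalRing.residue O (δ d)) := by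
  obtain ⟨ρ₀, R, ⟨P, hP⟩, hτ⟩ := hred
  -- the frame `P⁻¹ Q` of the integral model, with the same triangular shape
  have hQ' : ∀ d, ((P⁻¹ * Q)⁻¹ * Matrix.GeneralLinearGroup.map O.subtype (ρ₀ d) * (P⁻¹ * Q)) =
      Q⁻¹ * ρ d * Q := by
    intro d
    rw [hP d]
    group
  obtain ⟨Q₀, hQ₀⟩ := exists_integralFrame_of_frame (fun d ↦ ρ₀ d) (P⁻¹ * Q)
    (fun d ↦ by rw [hQ' d]; exact hQ d)
  set r := ι.comp (IsLocalRing.residue O) with hr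
  refine ⟨R * Matrix.GeneralLinearGroup.map r Q₀, fun d ↦ (Q₀⁻¹ * ρ₀ d * Q₀).val 0 0,
    fun d ↦ (Q₀⁻¹ * ρ₀ d * Q₀).val 1 1, fun d ↦ ⟨?_, ?_, ?_, ?_⟩⟩
  · obtain ⟨-, h00, h11⟩ := hQ₀ d
    rw [hQ' d] at h00 h11
    exact ⟨h00, h11⟩
  all_goals
    have hconj : (R * Matrix.GeneralLinearGroup.map r Q₀)⁻¹ * τ d *
        (R * Matrix.GeneralLinearGroup.map r Q₀) =
        (Matrix.GeneralLinearGroup.map r Q₀)⁻¹ * integralReduction ι ρ₀ d *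
          Matrix.GeneralLinearGroup.map r Q₀ := by
      rw [hτ d]
      group
    rw [hconj, hr, integralReduction_conj]
  · rw [(hQ₀ d).1, map_zero, map_zero]

end Reduction

/-! ### Corollary of the fact: residual ordinarity at `p`, with `δ̄(Frob) = ᾱ ≡ a_p` -/

section Residual

open CongruenceSubgroup UpperHalfPlane IsDedekindDomain Field
open Literature.NumberTheory.EllipticCurves.ModularForms
open scoped NumberField

/-- In the valuation ring `ℤ̄_p` of `ℚ̄_p`, elements of absolute value `< 1` lie in the maximal
ideal (a unit has absolute value `1`). [folklore] -/
private lemma mem_maximalIdeal_of_v_lt_one {p : ℕ} [Fact p.Prime] {x : padicAlgClIntegers p}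
    (hx : Valued.v (x : PadicAlgCl p) < 1) : x ∈ IsLocalRing.maximalIdeal (padicAlgClIntegers p) := by
  rw [IsLocalRing.mem_maximalIdeal, mem_nonunits_iff]
  rintro ⟨u, rfl⟩
  have h1 : Valued.v ((u : padicAlgClIntegers p) : PadicAlgCl p) *
      Valued.v (((u⁻¹ : (padicAlgClIntegers p)ˣ) : padicAlgClIntegers p) : PadicAlgCl p) = 1 := by
    rw [← map_mul, ← Subring.coe_mul]
    have := congrArg (fun y : padicAlgClIntegers p ↦ Valued.v (y : PadicAlgCl p)) u.mul_inv
    simpa only [Units.val_one, OneMemClass.coe_one, map_one] using this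
  have h2 : Valued.v (((u⁻¹ : (padicAlgClIntegers p)ˣ) : padicAlgClIntegers p) : PadicAlgCl p) ≤ 1 :=
    (Valuation.mem_valuationSubring_iff _ _).mp (SetLike.coe_mem _)
  have h3 : Valued.v ((u : padicAlgClIntegers p) : PadicAlgCl p) *
      Valued.v (((u⁻¹ : (padicAlgClIntegers p)ˣ) : padicAlgClIntegers p) : PadicAlgCl p) < 1 * 1 :=
    mul_lt_mul_of_lt_of_le_of_nonneg_of_pos hx h2 zero_le zero_lt_one
  rw [h1, one_mul] at h3
  exact lt_irrefl _ h3

/-- **Corollary of `Hida2000_thm326_ordinary_unitRoot`: every reduction of `ρ` is ordinary at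
`p`, with unramified quotient `δ̄` and `δ̄(Frob_w) = ᾱ ≡ a_p (mod 𝔪)` (Deligne's theorem in
residual form).**  Granted the fact, for `g`, `k ≥ 2`, `p ∤ N`, `ι`, an irreducible attached `ρ`
over `ℚ̄_p` and `w ∣ p` as there, and for ANY reduction `τ : Γ_ℚ → GL₂(k)` of `ρ` along
`ι' : ℤ̄_p/𝔪 → k` (any stable `ℤ̄_p`-lattice, any basis: `FramedGaloisRep.IsReductionOf`): the
frame `Q` and unit root `α` of the fact come with `ℤ̄_p`-valued diagonal characters `a` (upper
left) and `δ` (lower right) of `Q⁻¹ρ|_{Γ_{ℚ_w}}Q`, and a residual frame `Q̄ ∈ GL₂(k)` in which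
`τ|_{Γ_{ℚ_w}}` (restriction along `absGaloisRestrict`) is upper triangular with diagonal
`(a mod 𝔪, δ mod 𝔪)` — by `IsReductionOf.exists_upperTriangular_frame` (Wiles 1988,
pp. 562–563, the lattice step of Thm. 2.2.2 ⇒ Thm. 2.1.4); on inertia `δ = 1` and
`a = ν^{k−1}`, at every arithmetic Frobenius `δ = α`, and `δ ≡ x (mod 𝔪)` for any `x ∈ ℤ̄_p`
lifting `ι⁻¹(a_p(g))` (the unit root is `≡ a_p`, `exists_heckeUnitRoot`).  This residual shape —
`ρ̄_g|_{D_p} ≅ (ν̄^{k−1}·unr ∗; 0 unr(a_p))` — is the form in which the theorem is printed for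
`ρ̄` by Edixhoven, Invent. Math. 109 (1992), Thm. 2.5 (Deligne).
[cite: Hida2000, Thm. 3.26 (2), p. 152] [cite: Wiles1988, §2.2, pp. 562–563]
[cite: Edixhoven1992, Thm. 2.5] -/
theorem Hida2000_thm326_ordinary_unitRoot.exists_residualFrame
    (h : Hida2000_thm326_ordinary_unitRoot) {N : ℕ} [NeZero N] {k : ℤ}
    (g : CuspForm (Gamma1 N) k) (hk : 2 ≤ k) (hg : IsNewform1 g) (p : ℕ) [Fact p.Prime]
    (ι : PadicAlgCl p ≃+* ℂ) (hpN : ¬ p ∣ N)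
    (hap : Valued.v (ι.symm ((qExpansion 1 ⇑g).coeff p)) = 1)
    (ρ : FramedGaloisRep ℚ (PadicAlgCl p) 2)
    (hρ : IsGaloisRepOfNewform1 g
      ((ι.symm : ℂ →+* PadicAlgCl p).comp (algebraMap (coeffCharField g) ℂ)) {q | q ∣ N * p} ρ)
    (hirr : ρ.toGaloisRep.IsIrreducible) (w : HeightOneSpectrum (𝓞 ℚ))
    (hw : (p : 𝓞 ℚ) ∈ w.asIdeal) {kk : Type*} [Field kk] {ι' : padicAlgClResidueField p →+* kk}
    {τ : absoluteGaloisGroup ℚ →* GL (Fin 2) kk} (hτ : ρ.IsReductionOf ι' τ) :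
    ∃ (Q : GL (Fin 2) (PadicAlgCl p)) (α : PadicAlgCl p) (Qbar : GL (Fin 2) kk)
      (a δ : absoluteGaloisGroup (w.adicCompletion ℚ) → padicAlgClIntegers p),
      Valued.v α = 1 ∧
      α ^ 2 - ι.symm ((qExpansion 1 ⇑g).coeff p) * α +
        ι.symm ((nebentypus g (p : ZMod N) : ℂ) * (p : ℂ) ^ (k - 1)) = 0 ∧
      ∀ σ,
        ((Q⁻¹ * ρ.toLocal w σ * Q).val 1 0 = 0 ∧
          (a σ : PadicAlgCl p) = (Q⁻¹ * ρ.toLocal w σ * Q).val 0 0 ∧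
          (δ σ : PadicAlgCl p) = (Q⁻¹ * ρ.toLocal w σ * Q).val 1 1) ∧
        ((Qbar⁻¹ * τ (absGaloisRestrict ℚ (w.adicCompletion ℚ) σ) * Qbar).val 1 0 = 0 ∧
          (Qbar⁻¹ * τ (absGaloisRestrict ℚ (w.adicCompletion ℚ) σ) * Qbar).val 0 0 =
            ι' (IsLocalRing.residue _ (a σ)) ∧
          (Qbar⁻¹ * τ (absGaloisRestrict ℚ (w.adicCompletion ℚ) σ) * Qbar).val 1 1 =
            ι' (IsLocalRing.residue _ (δ σ))) ∧
        (σ ∈ absInertia (w.adicCompletion ℚ) →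
          δ σ = 1 ∧
          (a σ : PadicAlgCl p) = algebraMap (Padic p) (PadicAlgCl p)
            (((GaloisRep.cyclotomicCharacter (w.adicCompletion ℚ) p σ).val : PadicInt p) : Padic p) ^
              (k - 1)) ∧
        (IsAbsArithFrob σ →
          (δ σ : PadicAlgCl p) = α ∧
          ∀ x : padicAlgClIntegers p, (x : PadicAlgCl p) = ι.symm ((qExpansion 1 ⇑g).coeff p) →
            IsLocalRing.residue _ (δ σ) = IsLocalRing.residue _ x) := by
  obtain ⟨Q, α, hvα, hαr, hQ⟩ := h g hk hg p ι hpN hap ρ hρ hirr w hw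
  -- restriction to `Γ_{ℚ_w}` of `ρ` and of its reduction `τ`
  set res := (absGaloisRestrict ℚ (w.adicCompletion ℚ)).toMonoidHom with hres
  set ρw : absoluteGaloisGroup (w.adicCompletion ℚ) →* GL (Fin 2) (PadicAlgCl p) :=
    (ρ : absoluteGaloisGroup ℚ →* GL (Fin 2) (PadicAlgCl p)).comp res with hρw
  have hρw_apply : ∀ σ, ρw σ = ρ.toLocal w σ := fun σ ↦ rfl
  have hτw : GaloisRepresentations.IsReductionOf ι' ρw (τ.comp res) := by
    obtain ⟨ρ₀, R, ⟨P, hP⟩, hR⟩ := hτ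
    exact ⟨ρ₀.comp res, R, ⟨P, fun σ ↦ hP (res σ)⟩, fun σ ↦ hR (res σ)⟩
  obtain ⟨Qbar, a, δ, H⟩ := hτw.exists_upperTriangular_frame Q (fun σ ↦ (hQ σ).1)
  -- the unit root is `≡ a_p`
  obtain ⟨β, hvβ, hβr, hcong⟩ := exists_heckeUnitRoot g hk ι hpN hap
  have hαβ : α = β :=
    (existsUnique_heckeUnitRoot g hk ι hpN hap).unique ⟨hvα, hαr⟩ ⟨hvβ, hβr⟩
  refine ⟨Q, α, Qbar, a, δ, hvα, hαr, fun σ ↦ ⟨⟨(hQ σ).1, (H σ).1⟩, (H σ).2, fun hσ ↦ ?_,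
    fun hσ ↦ ?_⟩⟩
  · obtain ⟨h11, h00⟩ := (hQ σ).2.1 hσ
    refine ⟨Subtype.ext ?_, ?_⟩
    · rw [(H σ).1.2, OneMemClass.coe_one]
      exact h11
    · rw [(H σ).1.1]
      exact h00
  · have hδ : (δ σ : PadicAlgCl p) = α := by rw [(H σ).1.2]; exact (hQ σ).2.2 hσ
    refine ⟨hδ, fun x hx ↦ ?_⟩
    rw [← sub_eq_zero, ← map_sub, IsLocalRing.residue_eq_zero_iff]
    apply mem_maximalIdeal_of_v_lt_one
    rw [AddSubgroupClass.coe_sub, hδ, hx, hαβ, ← Valuation.map_neg, neg_sub]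
    exact hcong

end Residual

/-! ### Ordinary lines from traces (Wiles 1988, Lemma 2.2.4, first step, p. 565) -/

section TraceForm

open Literature.RepresentationTheory.Semisimple

variable {F : Type*} [Field F] {D : Type*} [Group D]

/-- A non-zero vector of `F²` is the first column of an invertible matrix. [folklore] -/
theorem exists_frame_col_eq (v : Fin 2 → F) (hv : v ≠ 0) :
    ∃ P : GL (Fin 2) F, (fun i ↦ (P : Matrix (Fin 2) (Fin 2) F) i 0) = v := by
  by_cases h0 : v 0 ≠ 0
  · refine ⟨Matrix.GeneralLinearGroup.mkOfDetNeZero !![v 0, 0; v 1, 1]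
      (by rw [Matrix.det_fin_two_of]; simpa using h0), ?_⟩
    ext i; fin_cases i <;> rfl
  · have h1 : v 1 ≠ 0 := by
      intro h1
      apply hv
      ext i; fin_cases i
      · exact not_not.mp h0
      · exact h1
    refine ⟨Matrix.GeneralLinearGroup.mkOfDetNeZero !![v 0, 1; v 1, 0]
      (by rw [Matrix.det_fin_two_of]; simpa using h1), ?_⟩
    ext i; fin_cases i <;> rfl

/-- **A common eigenvector from the trace (Wiles 1988, p. 565).**  If `ρ : D → GL₂(F)` over a
field `F` has `tr ρ = χ₁ + χ₂` and `det ρ = χ₁χ₂` for two characters `χ₁, χ₂ : D → Fˣ`, then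
`ρ` has a `D`-stable line.  For if the representation on `F²` were irreducible it would be
semisimple with the characteristic polynomials `(X − χ₁(d))(X − χ₂(d))` of the semisimple
`χ₁ ⊕ χ₂`, hence equivalent to it by the Brauer–Nesbitt theorem (`brauerNesbitt_holds`, Bourbaki
*Algèbre* VIII §20 n°6 Cor. 1 — here through
`Literature.RepresentationTheory.Semisimple.Representation.nonempty_equiv_of_charpoly_eq`), and
`χ₁ ⊕ χ₂` is reducible.  This is the step "their traces … are equal … and so the two
representations have isomorphic semisimplifications … Clearly there is [a subspace of dimension
one] on which the action is either via `σ` or `σ⁻¹ det ρ`" of Wiles, *Invent. Math.* 94 (1988),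
proof of Lemma 2.2.4, p. 565. [cite: Wiles1988, Lemma 2.2.4 (proof, p. 565)] -/
theorem exists_eigenvector_of_trace_eq_add_of_det_eq_mul (ρ : D →* GL (Fin 2) F)
    (χ₁ χ₂ : D →* Fˣ) (htr : ∀ d, (ρ d).val.trace = χ₁ d + χ₂ d)
    (hdet : ∀ d, (ρ d).val.det = χ₁ d * χ₂ d) :
    ∃ v : Fin 2 → F, v ≠ 0 ∧ ∀ d, ∃ c : F, (ρ d).val *ᵥ v = c • v := by
  classical
  set R : Representation F D (Fin 2 → F) :=
    (Representation.ofDistribMulAction F (GL (Fin 2) F) (Fin 2 → F)).comp ρ with hR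
  have hRapply : ∀ (d : D) (v : Fin 2 → F), R d v = (ρ d).val *ᵥ v := fun _ _ ↦ rfl
  have hbot : (⊥ : Subrepresentation R).toSubmodule = ⊥ := rfl
  have htop : (⊤ : Subrepresentation R).toSubmodule = ⊤ := rfl
  -- `R` is reducible: otherwise Brauer–Nesbitt makes it equivalent to the reducible `χ₁ ⊕ χ₂`
  have hred : ¬ R.IsIrreducible := by
    intro hirr
    haveI : IsSimpleOrder (Subrepresentation R) := hirr
    haveI : R.IsSemisimpleRepresentation :=
      (inferInstance : ComplementedLattice (Subrepresentation R))
    obtain ⟨Dg, hDg⟩ := exists_diagonalHom (k := F)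
    set σ : D →* GL (Fin 2) F := Dg.comp (χ₁.prod χ₂) with hσ
    have hσval : ∀ d, (σ d).val = Matrix.diagonal ![(χ₁ d : F), (χ₂ d : F)] := fun d ↦ hDg _
    set S : Representation F D (Fin 2 → F) :=
      (Representation.ofDistribMulAction F (GL (Fin 2) F) (Fin 2 → F)).comp σ with hS
    have hSapply : ∀ (d : D) (v : Fin 2 → F), S d v = (σ d).val *ᵥ v := fun _ _ ↦ rfl
    haveI : S.IsSemisimpleRepresentation :=
      isSemisimpleRepresentation_diagonal_fin_two σ fun d ↦ ⟨_, hσval d⟩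
    have hcp : ∀ d, (R d).charpoly = (S d).charpoly := by
      intro d
      have h1 : R d = Matrix.toLin' (ρ d).val :=
        LinearMap.ext fun v ↦ by rw [hRapply, Matrix.toLin'_apply]
      have h2 : S d = Matrix.toLin' (σ d).val :=
        LinearMap.ext fun v ↦ by rw [hSapply, Matrix.toLin'_apply]
      rw [h1, h2, Matrix.charpoly_toLin', Matrix.charpoly_toLin', Matrix.charpoly_fin_two,
        Matrix.charpoly_fin_two, htr, hdet, hσval, Matrix.trace_fin_two, Matrix.det_fin_two]
      simp
    obtain ⟨e⟩ := Representation.nonempty_equiv_of_charpoly_eq R S hcp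
    haveI hSirr : IsSimpleOrder (Subrepresentation S) := Representation.isIrreducible_of_equiv e
    -- but the coordinate line `F e₀` is a proper non-zero subrepresentation of `S = χ₁ ⊕ χ₂`
    let L : Subrepresentation S :=
      ⟨F ∙ (Pi.single 0 1 : Fin 2 → F), fun d v hv ↦ by
        rw [hSapply, hσval]
        exact diagonal_mulVec_mem_span_single _ 0 hv⟩
    have hLsub : L.toSubmodule = F ∙ (Pi.single 0 1 : Fin 2 → F) := rfl
    have hbotS : (⊥ : Subrepresentation S).toSubmodule = ⊥ := rfl
    have htopS : (⊤ : Subrepresentation S).toSubmodule = ⊤ := rfl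
    rcases eq_bot_or_eq_top L with h | h
    · have hmem : (Pi.single 0 1 : Fin 2 → F) ∈ L.toSubmodule :=
        hLsub ▸ Submodule.mem_span_singleton_self _
      rw [h, hbotS, Submodule.mem_bot] at hmem
      have h0 : (1 : F) = 0 := by simpa using congr_fun hmem 0
      exact one_ne_zero h0
    · have hmem : (Pi.single 1 1 : Fin 2 → F) ∈ L.toSubmodule := by
        rw [h, htopS]; exact Submodule.mem_top
      rw [hLsub, Submodule.mem_span_singleton] at hmem
      obtain ⟨c, hc⟩ := hmem
      have := congr_fun hc 1
      simp at this
  -- a stable line `F w`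
  obtain ⟨W, hW0, hW1⟩ : ∃ W : Subrepresentation R, W ≠ ⊥ ∧ W ≠ ⊤ := by
    by_contra hcon
    push Not at hcon
    have hbt : (⊥ : Subrepresentation R) ≠ ⊤ := by
      intro h
      have h' := congrArg Subrepresentation.toSubmodule h
      rw [hbot, htop] at h'
      exact bot_ne_top h'
    haveI : Nontrivial (Subrepresentation R) := ⟨⟨⊥, ⊤, hbt⟩⟩
    exact hred ⟨fun W ↦ or_iff_not_imp_left.mpr (hcon W)⟩
  have hW0' : W.toSubmodule ≠ ⊥ := fun h ↦ hW0 (Subrepresentation.toSubmodule_injective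
    (by rw [h, hbot]))
  have hW1' : W.toSubmodule ≠ ⊤ := fun h ↦ hW1 (Subrepresentation.toSubmodule_injective
    (by rw [h, htop]))
  have hWrank : Module.finrank F W.toSubmodule = 1 := finrank_eq_one_of_ne_bot_of_ne_top hW0' hW1'
  obtain ⟨w, hwW, hw0⟩ := Submodule.exists_mem_ne_zero_of_ne_bot hW0'
  have hmult : ∀ v ∈ W.toSubmodule, ∃ c : F, c • w = v := by
    intro v hv
    have h1 := (finrank_eq_one_iff_of_nonzero' (⟨w, hwW⟩ : W.toSubmodule)
      (by exact_mod_cast Subtype.coe_ne_coe.mp hw0 : (⟨w, hwW⟩ : W.toSubmodule) ≠ 0)).mp hWrank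
        ⟨v, hv⟩
    obtain ⟨c, hc⟩ := h1
    exact ⟨c, by simpa using congrArg Subtype.val hc⟩
  refine ⟨w, hw0, fun d ↦ ?_⟩
  obtain ⟨c, hc⟩ := hmult _ (W.apply_mem_toSubmodule d hwW)
  exact ⟨c, by rw [← hRapply, hc]⟩

/-- The upper-left entries of a simultaneously upper-triangular family multiply. [folklore] -/
private lemma conj_apply_zero_zero_mul (ρ : D →* GL (Fin 2) F) (P : GL (Fin 2) F)
    (h10 : ∀ d, (P⁻¹ * ρ d * P).val 1 0 = 0) (d e : D) :
    (P⁻¹ * ρ (d * e) * P).val 0 0 = (P⁻¹ * ρ d * P).val 0 0 * (P⁻¹ * ρ e * P).val 0 0 := by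
  have hprod : P⁻¹ * ρ (d * e) * P = (P⁻¹ * ρ d * P) * (P⁻¹ * ρ e * P) := by
    rw [map_mul]; group
  rw [hprod, Units.val_mul, Matrix.mul_apply, Fin.sum_univ_two, h10 e, mul_zero, add_zero]

/-- **The diagonal of ANY upper-triangular frame is `(χ₁, χ₂)` or `(χ₂, χ₁)`.**  If
`tr ρ = χ₁ + χ₂` and `det ρ = χ₁χ₂` for characters `χ₁, χ₂ : D → Fˣ` (`F` a field), and `ρ` is
upper triangular in the frame `P`, then the diagonal characters `(ψ, ψ')` of `P⁻¹ρP` are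
`(χ₁, χ₂)` or `(χ₂, χ₁)`: pointwise `(ψ − χ₁)(ψ − χ₂) = ψ² − tr·ψ + det = 0`, `ψ` is
multiplicative, and a group is not the union of its two proper subgroups `{ψ = χ₁}`, `{ψ = χ₂}`
(Jordan–Hölder for the two composition series). [folklore] -/
theorem conj_diag_eq_or_of_trace_eq_add_of_det_eq_mul (ρ : D →* GL (Fin 2) F)
    (χ₁ χ₂ : D →* Fˣ) (htr : ∀ d, (ρ d).val.trace = χ₁ d + χ₂ d)
    (hdet : ∀ d, (ρ d).val.det = χ₁ d * χ₂ d) (P : GL (Fin 2) F)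
    (h10 : ∀ d, (P⁻¹ * ρ d * P).val 1 0 = 0) :
    (∀ d, (P⁻¹ * ρ d * P).val 0 0 = χ₁ d ∧ (P⁻¹ * ρ d * P).val 1 1 = χ₂ d) ∨
      (∀ d, (P⁻¹ * ρ d * P).val 0 0 = χ₂ d ∧ (P⁻¹ * ρ d * P).val 1 1 = χ₁ d) := by
  -- the diagonal characters `ψ`, `ψ'`
  set ψ : D → F := fun d ↦ (P⁻¹ * ρ d * P).val 0 0 with hψ
  have hψ' : ∀ d, (P⁻¹ * ρ d * P).val 1 1 = χ₁ d + χ₂ d - ψ d := by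
    intro d
    have := conj_apply_one_one_eq_trace_sub (ρ d).val P
    simp only [Units.val_mul] at this ⊢
    rw [this, htr]
    rfl
  have hψdet : ∀ d, ψ d * (P⁻¹ * ρ d * P).val 1 1 = χ₁ d * χ₂ d := by
    intro d
    have hd : (P⁻¹ * ρ d * P).val.det = (ρ d).val.det := by
      rw [Units.val_mul, Units.val_mul]
      exact Matrix.det_units_conj' P (ρ d).val
    rw [Matrix.det_fin_two, h10 d, mul_zero, sub_zero, hdet] at hd
    exact hd
  -- pointwise `ψ = χ₁` or `ψ = χ₂`
  have hroot : ∀ d, ψ d = χ₁ d ∨ ψ d = χ₂ d := by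
    intro d
    have h0 : (ψ d - χ₁ d) * (ψ d - χ₂ d) = 0 := by
      have h1 := hψdet d
      rw [hψ' d] at h1
      linear_combination -h1
    rcases mul_eq_zero.mp h0 with h | h
    · exact Or.inl (sub_eq_zero.mp h)
    · exact Or.inr (sub_eq_zero.mp h)
  -- `ψ` is multiplicative, and a group is not a union of two proper subgroups
  have hmul : ∀ d e, ψ (d * e) = ψ d * ψ e := conj_apply_zero_zero_mul ρ P h10
  have hglobal : (∀ d, ψ d = χ₁ d) ∨ (∀ d, ψ d = χ₂ d) := by
    by_contra hcon
    push Not at hcon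
    obtain ⟨⟨x, hx⟩, ⟨y, hy⟩⟩ := hcon
    have hx' : ψ x = χ₂ x := (hroot x).resolve_left hx
    have hy' : ψ y = χ₁ y := (hroot y).resolve_right hy
    rcases hroot (x * y) with h | h
    · rw [hmul, hx', hy', map_mul, Units.val_mul] at h
      exact hx (hx'.trans (mul_right_cancel₀ (χ₁ y).ne_zero h))
    · rw [hmul, hx', hy', map_mul, Units.val_mul] at h
      exact hy (hy'.trans (mul_left_cancel₀ (χ₂ x).ne_zero h))
  refine hglobal.imp (fun h d ↦ ⟨h d, ?_⟩) (fun h d ↦ ⟨h d, ?_⟩)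
  · rw [hψ' d, h d]; ring
  · rw [hψ' d, h d]; ring

/-- **An ordinary line from the trace, with its characters (Wiles 1988, Lemma 2.2.4, first step,
p. 565).**  If `ρ : D → GL₂(F)` over a field `F` has `tr ρ = χ₁ + χ₂` and `det ρ = χ₁χ₂` for two
characters `χ₁, χ₂ : D → Fˣ`, then in some frame `P ∈ GL₂(F)` the representation is upper
triangular with diagonal characters `(χ₁, χ₂)` OR `(χ₂, χ₁)` — "there is [a line] on which the
action is either via `σ` or `σ⁻¹ det ρ`" (Wiles, loc. cit., with `χ₁ = σ⁻¹ det ρ`, `χ₂ = σ`).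
Proof: a stable line exists (`exists_eigenvector_of_trace_eq_add_of_det_eq_mul`, Brauer–Nesbitt)
and `conj_diag_eq_or_of_trace_eq_add_of_det_eq_mul`.  Which of the two orders occurs is NOT
determined by the trace (both occur for `χ₁ ⊕ χ₂`; only one for a non-split extension): in
Wiles's proof the wrong order is excluded by a second step (infinitely many ordinary
specializations, pp. 565–566). [cite: Wiles1988, Lemma 2.2.4 (proof, p. 565)] -/
theorem exists_upperTriangular_frame_of_trace_eq_add_of_det_eq_mul (ρ : D →* GL (Fin 2) F)
    (χ₁ χ₂ : D →* Fˣ) (htr : ∀ d, (ρ d).val.trace = χ₁ d + χ₂ d)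
    (hdet : ∀ d, (ρ d).val.det = χ₁ d * χ₂ d) :
    ∃ P : GL (Fin 2) F, (∀ d, (P⁻¹ * ρ d * P).val 1 0 = 0) ∧
      ((∀ d, (P⁻¹ * ρ d * P).val 0 0 = χ₁ d ∧ (P⁻¹ * ρ d * P).val 1 1 = χ₂ d) ∨
        (∀ d, (P⁻¹ * ρ d * P).val 0 0 = χ₂ d ∧ (P⁻¹ * ρ d * P).val 1 1 = χ₁ d)) := by
  obtain ⟨v, hv, heig⟩ := exists_eigenvector_of_trace_eq_add_of_det_eq_mul ρ χ₁ χ₂ htr hdet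
  obtain ⟨P, hP⟩ := exists_frame_col_eq v hv
  -- `P⁻¹ ρ P` is upper triangular
  have h10 : ∀ d, (P⁻¹ * ρ d * P).val 1 0 = 0 := by
    intro d
    obtain ⟨c, hc⟩ := heig d
    rw [← hP] at hc
    have := (conj_apply_col_zero_of_mulVec_frameCol_eq_smul (ρ d).val P hc).1
    simpa [Units.val_mul] using this
  exact ⟨P, h10, conj_diag_eq_or_of_trace_eq_add_of_det_eq_mul ρ χ₁ χ₂ htr hdet P h10⟩

end TraceForm

/-! ### The fact in trace form: `Hida2000_thm326_ordinary` + (tr, det) of `ρ|_{Γ_{ℚ_w}}` -/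

section TraceFormFact

open CongruenceSubgroup UpperHalfPlane IsDedekindDomain Field
open Literature.NumberTheory.EllipticCurves.ModularForms
open scoped NumberField

/-- The upper-left entry of `Q⁻¹ ρ(g) Q` is the diagonal entry of index `0` of `ρ.conj Q⁻¹`.
[folklore] -/
private theorem diagEntry_zero_conj_inv {G : Type*} [Group G] [TopologicalSpace G] {A : Type*}
    [CommRing A] [TopologicalSpace A] [IsTopologicalRing A] (ρ : FramedRep G A 2)
    (Q : GL (Fin 2) A) (g : G) : (ρ.conj Q⁻¹).diagEntry 0 g = (Q⁻¹ * ρ g * Q).val 0 0 := by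
  rw [FramedRep.diagEntry_apply, FramedRep.conj_apply, inv_inv]

/-- **The fact in trace form, `⇒`.**  Granted `Hida2000_thm326_ordinary_unitRoot`, for `g`,
`k ≥ 2`, `p ∤ N`, `ι`, an irreducible attached `ρ` over `ℚ̄_p` and `w ∣ p` as there, the class
functions `tr` and `det` of `ρ|_{Γ_{ℚ_w}}` decompose as `tr = ε + δ`, `det = εδ` for two
continuous characters `ε, δ : Γ_{ℚ_w} → ℚ̄_pˣ` with `δ` unramified (`δ = 1` on inertia),
`ε = ν^{k−1}` on inertia, and `δ(Frob_w) = α` the unit root of the `p`-th Hecke polynomial — the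
diagonal characters of the frame of the fact (`FramedRep.IsUpperTriangular.diagChar`).  This is
the frame-free (conjugation-invariant) content of the fact: the semisimplification of
`ρ|_{Γ_{ℚ_w}}` is `ε ⊕ δ`. [cite: Hida2000, Thm. 3.26 (2), p. 152]
[cite: Wiles1988, Lemma 2.2.4 (proof, p. 565)] -/
theorem Hida2000_thm326_ordinary_unitRoot.exists_traceForm
    (h : Hida2000_thm326_ordinary_unitRoot) {N : ℕ} [NeZero N] {k : ℤ}
    (g : CuspForm (Gamma1 N) k) (hk : 2 ≤ k) (hg : IsNewform1 g) (p : ℕ) [Fact p.Prime]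
    (ι : PadicAlgCl p ≃+* ℂ) (hpN : ¬ p ∣ N)
    (hap : Valued.v (ι.symm ((qExpansion 1 ⇑g).coeff p)) = 1)
    (ρ : FramedGaloisRep ℚ (PadicAlgCl p) 2)
    (hρ : IsGaloisRepOfNewform1 g
      ((ι.symm : ℂ →+* PadicAlgCl p).comp (algebraMap (coeffCharField g) ℂ)) {q | q ∣ N * p} ρ)
    (hirr : ρ.toGaloisRep.IsIrreducible) (w : HeightOneSpectrum (𝓞 ℚ))
    (hw : (p : 𝓞 ℚ) ∈ w.asIdeal) :
    ∃ (α : PadicAlgCl p) (ε δ : absoluteGaloisGroup (w.adicCompletion ℚ) →* (PadicAlgCl p)ˣ),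
      Valued.v α = 1 ∧
      α ^ 2 - ι.symm ((qExpansion 1 ⇑g).coeff p) * α +
        ι.symm ((nebentypus g (p : ZMod N) : ℂ) * (p : ℂ) ^ (k - 1)) = 0 ∧
      Continuous ε ∧ Continuous δ ∧
      (∀ σ, (ρ.toLocal w σ).val.trace = ε σ + δ σ ∧ (ρ.toLocal w σ).val.det = ε σ * δ σ) ∧
      (∀ σ ∈ absInertia (w.adicCompletion ℚ),
        (δ σ : PadicAlgCl p) = 1 ∧
        (ε σ : PadicAlgCl p) = algebraMap (Padic p) (PadicAlgCl p)
          (((GaloisRep.cyclotomicCharacter (w.adicCompletion ℚ) p σ).val : PadicInt p) : Padic p) ^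
            (k - 1)) ∧
      (∀ σ, IsAbsArithFrob σ → (δ σ : PadicAlgCl p) = α) := by
  obtain ⟨Q, α, hvα, hαr, hQ⟩ := h g hk hg p ι hpN hap ρ hρ hirr w hw
  have hUT := isUpperTriangular_conj_inv_of_apply_one_zero_eq_zero (ρ := ρ.toLocal w)
    (fun σ ↦ (hQ σ).1)
  have hε : ∀ σ, (hUT.diagChar 0 σ : PadicAlgCl p) = (Q⁻¹ * ρ.toLocal w σ * Q).val 0 0 :=
    fun σ ↦ by rw [FramedRep.IsUpperTriangular.val_diagChar_apply, diagEntry_zero_conj_inv]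
  have hδ : ∀ σ, (hUT.diagChar 1 σ : PadicAlgCl p) = (Q⁻¹ * ρ.toLocal w σ * Q).val 1 1 :=
    fun σ ↦ by rw [FramedRep.IsUpperTriangular.val_diagChar_apply, diagEntry_one_conj_inv]
  refine ⟨α, hUT.diagChar 0, hUT.diagChar 1, hvα, hαr, ?_, ?_, fun σ ↦ ⟨?_, ?_⟩,
    fun σ hσ ↦ ⟨?_, ?_⟩, fun σ hσ ↦ ?_⟩
  · refine Units.isEmbedding_val₀.continuous_iff.2 ?_
    simp only [Function.comp_def, FramedRep.IsUpperTriangular.val_diagChar_apply]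
    exact FramedRep.continuous_diagEntry _ 0
  · refine Units.isEmbedding_val₀.continuous_iff.2 ?_
    simp only [Function.comp_def, FramedRep.IsUpperTriangular.val_diagChar_apply]
    exact FramedRep.continuous_diagEntry _ 1
  · rw [hε, hδ]
    have := conj_apply_one_one_eq_trace_sub (ρ.toLocal w σ).val Q
    simp only [Units.val_mul] at this ⊢
    rw [this]; ring
  · rw [hε, hδ, ← det_val_conj Q (ρ.toLocal w σ), Matrix.det_fin_two, (hQ σ).1, mul_zero,
      sub_zero]
  · rw [hδ]; exact ((hQ σ).2.1 hσ).1
  · rw [hε]; exact ((hQ σ).2.1 hσ).2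
  · rw [hδ]; exact (hQ σ).2.2 hσ

open Rat.HeightOneSpectrum in
/-- **`Hida2000_thm326_ordinary_unitRoot` = `Hida2000_thm326_ordinary` + the TRACE of
`ρ|_{Γ_{ℚ_w}}`.**  The fact with the unit root is equivalent to the conjunction of the landed
`Hida2000_thm326_ordinary` (an ordinary frame at `w ∣ p`) and of the frame-free statement: for
`g`, `p`, `ι`, `ρ`, `w` as there, `tr ρ|_{Γ_{ℚ_w}} = ε + δ` and `det ρ|_{Γ_{ℚ_w}} = εδ` for two
characters `ε, δ : Γ_{ℚ_w} → ℚ̄_pˣ` with `δ = 1` on inertia and `δ(Frob_w) = α`, a unit root of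
`X² − ι⁻¹(a_p)X + ι⁻¹(χ(p)p^{k−1})` — i.e. a statement about the SEMISIMPLIFICATION of
`ρ|_{Γ_{ℚ_w}}` only.  `⇒`: `Hida2000_thm326_ordinary_unitRoot.exists_traceForm`.  `⇐` (Wiles
1988, Lemma 2.2.4, first step, made unconditional by the inertia weights): the diagonal
`(ε', δ')` of the ordinary frame of `Hida2000_thm326_ordinary` is `(ε, δ)` or `(δ, ε)`
(`conj_diag_eq_or_of_trace_eq_add_of_det_eq_mul`); the swap would force `ν^{k−1} = ε' = δ = 1`
on the inertia group, which contains an element with `ν = 1 + p`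
(`adicCompletion_rat_exists_mem_absInertia_cyclotomicCharacter_eq`, `exists_unit_pow_ne_one`);
so `δ' = δ` and `δ'(Frob_w) = α`. [cite: Hida2000, Thm. 3.26 (2), p. 152]
[cite: Wiles1988, Lemma 2.2.4 (proof, p. 565)] -/
theorem Hida2000_thm326_ordinary_unitRoot_iff_ordinary_and_traceForm :
    Hida2000_thm326_ordinary_unitRoot ↔
      Hida2000_thm326_ordinary ∧
      ∀ {N : ℕ} [NeZero N] {k : ℤ} (g : CuspForm (CongruenceSubgroup.Gamma1 N) k), 2 ≤ k →
        IsNewform1 g →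
        ∀ (p : ℕ) [Fact p.Prime] (ι : PadicAlgCl p ≃+* ℂ), ¬ p ∣ N →
        Valued.v (ι.symm ((UpperHalfPlane.qExpansion 1 ⇑g).coeff p)) = 1 →
        ∀ ρ : FramedGaloisRep ℚ (PadicAlgCl p) 2,
          IsGaloisRepOfNewform1 g
            ((ι.symm : ℂ →+* PadicAlgCl p).comp (algebraMap (coeffCharField g) ℂ))
            {q | q ∣ N * p} ρ → ρ.toGaloisRep.IsIrreducible →
        ∀ w : HeightOneSpectrum (𝓞 ℚ), (p : 𝓞 ℚ) ∈ w.asIdeal →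
        ∃ (α : PadicAlgCl p) (ε δ : absoluteGaloisGroup (w.adicCompletion ℚ) →* (PadicAlgCl p)ˣ),
          Valued.v α = 1 ∧
          α ^ 2 - ι.symm ((qExpansion 1 ⇑g).coeff p) * α +
            ι.symm ((nebentypus g (p : ZMod N) : ℂ) * (p : ℂ) ^ (k - 1)) = 0 ∧
          (∀ σ, (ρ.toLocal w σ).val.trace = ε σ + δ σ ∧ (ρ.toLocal w σ).val.det = ε σ * δ σ) ∧
          (∀ σ ∈ absInertia (w.adicCompletion ℚ), (δ σ : PadicAlgCl p) = 1) ∧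
          (∀ σ, IsAbsArithFrob σ → (δ σ : PadicAlgCl p) = α) := by
  constructor
  · intro h
    refine ⟨Hida2000_thm326_ordinary_of_unitRoot h, ?_⟩
    intro N _ k g hk hg p _ ι hpN hap ρ hρ hirr w hw
    obtain ⟨α, ε, δ, hvα, hαr, -, -, htr, hin, hfrob⟩ :=
      h.exists_traceForm g hk hg p ι hpN hap ρ hρ hirr w hw
    exact ⟨α, ε, δ, hvα, hαr, htr, fun σ hσ ↦ (hin σ hσ).1, hfrob⟩
  · rintro ⟨hord, htf⟩
    intro N _ k g hk hg p _ ι hpN hap ρ hρ hirr w hw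
    obtain ⟨Q, hQ⟩ := hord g hk hg p ι hpN hap ρ hρ hirr w hw
    obtain ⟨α, ε, δ, hvα, hαr, htr, hin, hfrob⟩ := htf g hk hg p ι hpN hap ρ hρ hirr w hw
    -- the diagonal of the ordinary frame `Q` is `(ε, δ)` or `(δ, ε)`
    have hdiag := conj_diag_eq_or_of_trace_eq_add_of_det_eq_mul
      (ρ.toLocal w : absoluteGaloisGroup (w.adicCompletion ℚ) →* GL (Fin 2) (PadicAlgCl p)) ε δ
      (fun σ ↦ (htr σ).1) (fun σ ↦ (htr σ).2) Q (fun σ ↦ (hQ σ).1)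
    rcases hdiag with hεδ | hδε
    · exact ⟨Q, α, hvα, hαr, fun σ ↦ ⟨(hQ σ).1, (hQ σ).2, fun hσ ↦ by
        rw [show (Q⁻¹ * ρ.toLocal w σ * Q).val 1 1 = δ σ from (hεδ σ).2, hfrob σ hσ]⟩⟩
    · -- the swap forces `ν^{k-1} = 1` on inertia: impossible
      exfalso
      have hp : p.Prime := Fact.out
      obtain ⟨m, hm⟩ : ∃ m : ℕ, ((m : ℕ) : ℤ) = k - 1 :=
        ⟨(k - 1).toNat, Int.toNat_of_nonneg (by omega)⟩
      have hm0 : 0 < m := by omega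
      have hgen : ((primesEquiv w : Nat.Primes) : ℕ) = p := by
        have hdvd : natGenerator w ∣ p := (Rat.natCast_mem_asIdeal_iff w).mp hw
        exact (Nat.prime_dvd_prime_iff_eq (primesEquiv w).2 hp).mp hdvd
      obtain ⟨u, hu⟩ := exists_unit_pow_ne_one p
      obtain ⟨τ, hτ, hντ⟩ :=
        adicCompletion_rat_exists_mem_absInertia_cyclotomicCharacter_eq p w hgen u
      -- `(Q⁻¹ρ(τ)Q)₀₀ = ν(τ)^{k-1}` (the ordinary frame) `= δ(τ) = 1` (the swap)
      have h00 : (Q⁻¹ * ρ.toLocal w τ * Q).val 0 0 = 1 := by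
        rw [show (Q⁻¹ * ρ.toLocal w τ * Q).val 0 0 = δ τ from (hδε τ).1]
        exact hin τ hτ
      rw [((hQ τ).2 hτ).2, hντ, ← hm, zpow_natCast, ← map_pow,
        map_eq_one_iff _ (algebraMap ℚ_[p] (PadicAlgCl p)).injective] at h00
      apply hu m hm0
      apply Units.ext
      apply PadicInt.ext
      rw [Units.val_pow_eq_pow_val, Units.val_one, PadicInt.coe_pow, PadicInt.coe_one]
      exact h00

end TraceFormFact

/-! ### Rigidity under specialization (Wiles 1988, Lemma 2.2.4, second step, pp. 565–566) -/

section Rigidity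

variable {D : Type*} [Group D]

/-- **Adapted frames.**  Over a field `L`, let `ρ` be upper triangular in the frame `P`, and let
`τ₀ ∈ D` have distinct diagonal entries there.  Then there is a frame `P' = P·(1 x; 0 1)` with the
same stable line and the same diagonal characters in which moreover `ρ(τ₀)` is DIAGONAL
(`x = b(τ₀)/(e(τ₀) − a(τ₀))` kills the corner at `τ₀`).  This is the basis "fixed … so that
`ρ|_{D_𝔭}` is triangular" of Wiles 1988, p. 565, normalised at an element separating the two
characters (condition (ii), p. 566). [cite: Wiles1988, Lemma 2.2.4 (proof, pp. 565–566)] -/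
theorem exists_adaptedFrame {L : Type*} [Field L] (ρ : D →* GL (Fin 2) L) (P : GL (Fin 2) L)
    (h10 : ∀ d, (P⁻¹ * ρ d * P).val 1 0 = 0) {τ₀ : D}
    (hτ₀ : (P⁻¹ * ρ τ₀ * P).val 0 0 ≠ (P⁻¹ * ρ τ₀ * P).val 1 1) :
    ∃ P' : GL (Fin 2) L,
      (∀ d, (P'⁻¹ * ρ d * P').val 1 0 = 0 ∧
        (P'⁻¹ * ρ d * P').val 0 0 = (P⁻¹ * ρ d * P).val 0 0 ∧
        (P'⁻¹ * ρ d * P').val 1 1 = (P⁻¹ * ρ d * P).val 1 1) ∧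
      (P'⁻¹ * ρ τ₀ * P').val 0 1 = 0 := by
  set a : L := (P⁻¹ * ρ τ₀ * P).val 0 0 with ha
  set b : L := (P⁻¹ * ρ τ₀ * P).val 0 1 with hb
  set e : L := (P⁻¹ * ρ τ₀ * P).val 1 1 with he
  have hae : e - a ≠ 0 := sub_ne_zero.mpr (Ne.symm hτ₀)
  set x : L := b / (e - a) with hx
  -- the unipotent change of frame `U = (1 x; 0 1)`
  let U : GL (Fin 2) L := ⟨!![1, x; 0, 1], !![1, -x; 0, 1],
    by ext i j; fin_cases i <;> fin_cases j <;> simp [Matrix.mul_apply, Fin.sum_univ_two],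
    by ext i j; fin_cases i <;> fin_cases j <;> simp [Matrix.mul_apply, Fin.sum_univ_two]⟩
  have hconj : ∀ d, (P * U)⁻¹ * ρ d * (P * U) = U⁻¹ * (P⁻¹ * ρ d * P) * U := fun d ↦ by group
  -- entries of `U⁻¹ N U` for an upper-triangular `N`
  have hentries : ∀ d,
      ((P * U)⁻¹ * ρ d * (P * U)).val 1 0 = 0 ∧
      ((P * U)⁻¹ * ρ d * (P * U)).val 0 0 = (P⁻¹ * ρ d * P).val 0 0 ∧
      ((P * U)⁻¹ * ρ d * (P * U)).val 1 1 = (P⁻¹ * ρ d * P).val 1 1 ∧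
      ((P * U)⁻¹ * ρ d * (P * U)).val 0 1 = (P⁻¹ * ρ d * P).val 0 1 +
        x * ((P⁻¹ * ρ d * P).val 0 0 - (P⁻¹ * ρ d * P).val 1 1) := by
    intro d
    rw [hconj d]
    set N := P⁻¹ * ρ d * P with hN
    have hN10 : (N : Matrix (Fin 2) (Fin 2) L) 1 0 = 0 := h10 d
    have u00 : (U : Matrix (Fin 2) (Fin 2) L) 0 0 = 1 := rfl
    have u01 : (U : Matrix (Fin 2) (Fin 2) L) 0 1 = x := rfl
    have u10 : (U : Matrix (Fin 2) (Fin 2) L) 1 0 = 0 := rfl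
    have u11 : (U : Matrix (Fin 2) (Fin 2) L) 1 1 = 1 := rfl
    have w00 : ((U⁻¹ : GL (Fin 2) L) : Matrix (Fin 2) (Fin 2) L) 0 0 = 1 := rfl
    have w01 : ((U⁻¹ : GL (Fin 2) L) : Matrix (Fin 2) (Fin 2) L) 0 1 = -x := rfl
    have w10 : ((U⁻¹ : GL (Fin 2) L) : Matrix (Fin 2) (Fin 2) L) 1 0 = 0 := rfl
    have w11 : ((U⁻¹ : GL (Fin 2) L) : Matrix (Fin 2) (Fin 2) L) 1 1 = 1 := rfl
    refine ⟨?_, ?_, ?_, ?_⟩ <;>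
      simp only [Units.val_mul, Matrix.mul_apply, Fin.sum_univ_two, u00, u01, u10, u11, w00, w01,
        w10, w11, hN10] <;> ring
  refine ⟨P * U, fun d ↦ ⟨(hentries d).1, (hentries d).2.1, (hentries d).2.2.1⟩, ?_⟩
  rw [(hentries τ₀).2.2.2, ← ha, ← hb, ← he, hx]
  field_simp
  ring

/-- **Rigidity of the ordinary line under specialization (Wiles 1988, Lemma 2.2.4, second step,
pp. 565–566).**  Let `ρ : D → GL₂(A)` over a commutative ring `A`, `ρ = (a b; c e)` (in the
application upper triangular, `c = 0`, in an adapted frame, `exists_adaptedFrame` — only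
`b(τ₀) = 0` for some `τ₀` is used), and let `φ_i : A → k_i` be a family of ring homomorphisms to fields
("specializations") which is jointly injective (`⋂ ker φ_i = 0`) and such that, for EVERY `i`,
`φ_i` separates `a(τ₀)` from `e(τ₀)` and the specialization `φ_i ∘ ρ` has a stable line on which
`D` acts through `φ_i ∘ e` (the QUOTIENT character when `c = 0`).  Then `b = 0`: for `c = 0`,
`ρ` is diagonal, and in particular has a stable line with character `e` and quotient `a` — the
opposite order.  (At `τ₀` such a line must be the second coordinate axis, so `φ_i(b(d)) = 0` for
all `d` and `i`.)
This is Wiles's argument, *Invent. Math.* 94 (1988), pp. 565–566: "for infinitely many `(k, ζ)`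
… we find that `b_σ ≡ 0 mod P_{k,ζ}` because in these cases Lemma 2.1.5 shows that
`(ρ|_{D_𝔭} mod P_{k,ζ})` has a subspace on which the action is via `σ⁻¹ det ρ`.  Hence `b_σ = 0`
for all `σ` and … `ρ|_{D_𝔭}` is completely reducible and so again has a subspace on which the
action is via `σ⁻¹ det ρ`" — there `A` is (a localization of) the finite normal `Λ`-algebra `O_L`,
the `φ_i` are the reductions modulo infinitely many height-one primes `P_{2,ζ}` (jointly
injective in a Noetherian domain), and the stable lines come from the weight-`2` case
(Lemma 2.1.5); those modular inputs are not in the tree.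
[cite: Wiles1988, Lemma 2.2.4 (proof, pp. 565–566)] -/
theorem apply_zero_one_eq_zero_of_specializations {A : Type*} [CommRing A] {I : Type*}
    {k : I → Type*} [∀ i, Field (k i)] (φ : ∀ i, A →+* k i)
    (hsep : ∀ y : A, (∀ i, φ i y = 0) → y = 0) (ρ : D →* GL (Fin 2) A)
    {τ₀ : D} (hτ₀ : (ρ τ₀).val 0 1 = 0)
    (hdist : ∀ i, φ i ((ρ τ₀).val 0 0) ≠ φ i ((ρ τ₀).val 1 1))
    (hline : ∀ i, ∃ v : Fin 2 → k i, v ≠ 0 ∧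
      ∀ d, ((ρ d).val.map (φ i)) *ᵥ v = φ i ((ρ d).val 1 1) • v) (d : D) :
    (ρ d).val 0 1 = 0 := by
  refine hsep _ fun i ↦ ?_
  obtain ⟨v, hv, hev⟩ := hline i
  -- at `τ₀` the line is an eigenline of `diag(a, e)` for `e ≠ a`: it is the second axis
  have hv0 : v 0 = 0 := by
    have h := congr_fun (hev τ₀) 0
    simp only [Matrix.mulVec, dotProduct, Fin.sum_univ_two, Matrix.map_apply, hτ₀, map_zero,
      zero_mul, add_zero, Pi.smul_apply, smul_eq_mul] at h
    -- `h : φ(a τ₀) * v 0 = φ(e τ₀) * v 0`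
    by_contra hv0
    exact hdist i (mul_right_cancel₀ hv0 h)
  have hv1 : v 1 ≠ 0 := by
    intro hv1
    apply hv
    ext j; fin_cases j
    · exact hv0
    · exact hv1
  -- first coordinate of `ρ(d) v = e(d) v` with `v = (0, v₁)`: `φ(b(d)) v₁ = 0`
  have h := congr_fun (hev d) 0
  simp only [Matrix.mulVec, dotProduct, Fin.sum_univ_two, Matrix.map_apply, hv0, mul_zero,
    zero_add, Pi.smul_apply, smul_eq_mul] at h
  exact (mul_eq_zero.mp h).resolve_right hv1

end Rigidity

end Literature.NumberTheory.EllipticCurves
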